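import Mathlib
import HarnessLib
import Summits.NavierStokesRegularity.NavierStokesRegularity.Theorems.TypeIQuarterGateScarEnvelopeTypeIForcedTsaiAlgSoundG
import Summits.NavierStokesRegularity.NavierStokesRegularity.Theorems.TypeIQuarterGateScarEnvelopeTypeIForcedTsaiAlgWitnessL1G

/-!
# ARM B lane E-exact — ℓ = 1 Type-I rows, EXACT WEIGHT, AS TREE THEOREMS: δ/M = 15.38 @¼ … 17.66 @4

Closers of kernel-checked LANEX-ALG v3 rows (Type-I-tail witnesses with exact far-field closure, the CERTIFIED
POLYNOMIAL LEVEL FLOOR `floorCertT3K30`, and the EXACT residual weight `(1+ρ)⁵` — no AM-GM majorant) through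
`AlgRowG.sound` (`…ForcedTsaiAlgSoundG`): certified UPPER bounds on the forced-Tsai modulus in the tree currency
(`ℝ³`, weight `(1+ρ)⁵`, level on `B₁₀`):
`δ*(1/4) ≤ 3.844` (δ/M = 15.38; v2 row (AM-GM radii) 15.87); `δ*(1/2) ≤ 7.702` (δ/M = 15.40; v2 row (AM-GM radii) 15.90); `δ*(1) ≤ 15.52` (δ/M = 15.52; v2 row (AM-GM radii) 16.04); `δ*(2) ≤ 31.93` (δ/M = 15.96; v2 row (AM-GM radii) 16.51); `δ*(4) ≤ 70.62` (δ/M = 17.66; v2 row (AM-GM radii) 18.26).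
«Near-profiles this good EXIST»; UPPER bounds only; excludes nothing; nothing about NS regularity; 23843 / H3 OPEN.
-/

set_option linter.dupNamespace false

namespace Summit.NavierStokesRegularity.NavierStokesRegularity.Cruxes.ScarEnvelopeTypeI.ForcedTsai

/-- `δ*(1/4) ≤ 961/250` ≈ 3.8440 (Type-I-tail class, exact closure, certified polynomial floor, EXACT weight; δ/M = 15.38; v2 row (AM-GM radii) 15.87). -/
theorem forcedTsaiModulusLE_algG_L1_1o4 : ForcedTsaiModulusLE (1 / 4 : ℝ) (961 / 250 : ℝ) := by
  have h := algRowGL1Gr0.sound algRowGL1Gr0_checkG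
  norm_num [algRowGL1Gr0] at h
  exact h

/-- `δ*(1/2) ≤ 3851/500` ≈ 7.7020 (Type-I-tail class, exact closure, certified polynomial floor, EXACT weight; δ/M = 15.40; v2 row (AM-GM radii) 15.90). -/
theorem forcedTsaiModulusLE_algG_L1_1o2 : ForcedTsaiModulusLE (1 / 2 : ℝ) (3851 / 500 : ℝ) := by
  have h := algRowGL1Gr1.sound algRowGL1Gr1_checkG
  norm_num [algRowGL1Gr1] at h
  exact h

/-- `δ*(1) ≤ 3879/250` ≈ 15.5160 (Type-I-tail class, exact closure, certified polynomial floor, EXACT weight; δ/M = 15.52; v2 row (AM-GM radii) 16.04). -/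
theorem forcedTsaiModulusLE_algG_L1_1 : ForcedTsaiModulusLE (1 : ℝ) (3879 / 250 : ℝ) := by
  have h := algRowGL1Gr2.sound algRowGL1Gr2_checkG
  norm_num [algRowGL1Gr2] at h
  exact h

/-- `δ*(2) ≤ 3991/125` ≈ 31.9280 (Type-I-tail class, exact closure, certified polynomial floor, EXACT weight; δ/M = 15.96; v2 row (AM-GM radii) 16.51). -/
theorem forcedTsaiModulusLE_algG_L1_2 : ForcedTsaiModulusLE (2 : ℝ) (3991 / 125 : ℝ) := by
  have h := algRowGL1Gr3.sound algRowGL1Gr3_checkG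
  norm_num [algRowGL1Gr3] at h
  exact h

/-- `δ*(4) ≤ 35311/500` ≈ 70.6220 (Type-I-tail class, exact closure, certified polynomial floor, EXACT weight; δ/M = 17.66; v2 row (AM-GM radii) 18.26). -/
theorem forcedTsaiModulusLE_algG_L1_4 : ForcedTsaiModulusLE (4 : ℝ) (35311 / 500 : ℝ) := by
  have h := algRowGL1Gr4.sound algRowGL1Gr4_checkG
  norm_num [algRowGL1Gr4] at h
  exact h

/-- Rounded: `ForcedTsaiModulusLE 1 (78/5)` (`δ/M ≤ 15.6` at level 1, ℓ = 1 Type-I-tail class, exact weight; cf. v2 `…_1_16p2`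
= `1 (81/5)` and v1 `…_1_17q` = `1 (69/4)`). -/
theorem forcedTsaiModulusLE_1_15p6 : ForcedTsaiModulusLE (1 : ℝ) (78 / 5 : ℝ) :=
  forcedTsaiModulusLE_algG_L1_1.mono le_rfl (by norm_num)

end Summit.NavierStokesRegularity.NavierStokesRegularity.Cruxes.ScarEnvelopeTypeI.ForcedTsai
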